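import Mathlib
import HarnessLib

/-!
# LINE (A) `product_plus_one` (crux `MatrixDescartes`, stmt-ValiantsHypothesis-18050, V1) — W-CB, brick G6: the `x ↦ 1/x` MIRROR IN W-CURRENCY

Every per-window W-cell of the lane (✓ `…RateSeparatedCell`, ✓ `…SixthOrderCell` (E3b, ratio `s ≥ 2p`), `…EighthOrderCell` (E4♯c, `p ≤ s ≤ 2p`), …) is
stated for gap rates `p = d 1 − d 0`, `s = d 2 − d 1`; the remaining supports (`s < p`) are their mirrors under `x ↦ 1/x`, which reverses the support
(`d ↦ D − d`) and swaps the gaps.  This file types the mirror ONCE, for the Wronskian itself: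
* `hasDerivAt_pow_mul_eval_inv` — `θ (t^N · Q(1/t)) = t^N · (N·Q − θQ)(1/t)` (`θ = t·d/dt`);
* `theta_eval_reverse` — if `P̃(t) = t^N P(1/t)` on `t ≠ 0` then `(θP̃)(t) = t^N (N P − θP)(1/t)` on `t ≠ 0`;
* ★ `wronskian_eval_reverse` — then `W(P̃)(t) = t^{2N} · W(P)(1/t)` on `t ≠ 0`, `W(Q) = Q·θ²Q − (θQ)²`;
* `wronskian_eq_zero_of_reverse`, ★ `wronskian_roots_window_reverse` (`#{roots of W(P̃) in (u,v)} = #{roots of W(P) in (1/v,1/u)}`, `0 < u, v`),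
  ★ `wronskian_posRoots_reverse` (equal numbers of positive roots);
* `company_eval_reverse` + ★★ `company_wronskian_roots_window_reverse` / ★★ `company_wronskian_posRoots_reverse` — the instances for a company
  `∏_j Σ_l C (a j l) X^{d l}` and its reversal `∏_j Σ_l C (a j l) X^{D − d l}` (`d l ≤ D`, `N = m·D`), in the LINE's literal `W` shape.

HONEST FRAMING: bookkeeping (calculus + a bijection `t ↦ t⁻¹`); proves nothing about `WronskianBudgetK3` / `OneChangeFloorK3` / the stubs / 18050 /
`MatrixDescartes` / Conjecture B by itself; `VP ≠ VNP` is NOT proved.  No definitions, no named facts, no sorry; Mathlib only.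
-/

set_option linter.dupNamespace false

namespace Summit.ValiantsHypothesis.ValiantsHypothesis.Theorems.LacunarySymmetroidMatrixDescartes

namespace ProductPlusOne

open Finset Set Polynomial
open scoped BigOperators Topology Polynomial

/-! ### §1 Calculus of `t ↦ t^N · Q(1/t)` -/

/-- `θ (t^N · Q(1/t)) = t^N · (N·Q − θQ)(1/t)`, written as a derivative divided by `t`. [folklore] -/
theorem hasDerivAt_pow_mul_eval_inv (Q : ℝ[X]) (N : ℕ) {t : ℝ} (ht : t ≠ 0) :
    HasDerivAt (fun x : ℝ => x ^ N * Q.eval x⁻¹) ((t ^ N * (C (N : ℝ) * Q - X * derivative Q).eval t⁻¹) / t) t := by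
  have h1 : HasDerivAt (fun x : ℝ => x ^ N) ((N : ℝ) * t ^ (N - 1)) t := hasDerivAt_pow N t
  have h2 : HasDerivAt (fun x : ℝ => Q.eval x⁻¹) ((derivative Q).eval t⁻¹ * (-(t ^ 2)⁻¹)) t :=
    (Polynomial.hasDerivAt Q t⁻¹).comp t (hasDerivAt_inv ht)
  refine (h1.mul h2).congr_deriv ?_
  simp only [eval_sub, eval_mul, eval_C, eval_X]
  rcases Nat.eq_zero_or_pos N with h0 | hpos
  · subst h0
    simp only [pow_zero, Nat.cast_zero, zero_mul, one_mul, zero_add, zero_sub]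
    field_simp
  · obtain ⟨k, rfl⟩ : ∃ k, N = k + 1 := ⟨N - 1, by omega⟩
    simp only [Nat.add_sub_cancel, pow_succ, Nat.cast_add, Nat.cast_one]
    field_simp
    ring

/-- **First `θ`-derivative of a reversal**: if `P̃(t) = t^N · P(1/t)` for `t ≠ 0`, then `(θP̃)(t) = t^N · (N·P − θP)(1/t)` for `t ≠ 0`.
[folklore] -/
theorem theta_eval_reverse (P Pr : ℝ[X]) (N : ℕ) (h : ∀ t : ℝ, t ≠ 0 → Pr.eval t = t ^ N * P.eval t⁻¹) {t : ℝ} (ht : t ≠ 0) :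
    (X * derivative Pr).eval t = t ^ N * (C (N : ℝ) * P - X * derivative P).eval t⁻¹ := by
  have hPr : HasDerivAt (fun x : ℝ => Pr.eval x) ((derivative Pr).eval t) t := Polynomial.hasDerivAt Pr t
  have hev : (fun x : ℝ => x ^ N * P.eval x⁻¹) =ᶠ[𝓝 t] (fun x : ℝ => Pr.eval x) := by
    filter_upwards [isOpen_ne.mem_nhds ht] with x hx
    exact (h x hx).symm
  have hrev : HasDerivAt (fun x : ℝ => Pr.eval x) ((t ^ N * (C (N : ℝ) * P - X * derivative P).eval t⁻¹) / t) t :=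
    (hasDerivAt_pow_mul_eval_inv P N ht).congr_of_eventuallyEq hev.symm
  have heq := hPr.unique hrev
  rw [eval_mul, eval_X, heq]
  field_simp

/-- `θ(N·P − θP) = N·θP − θ²P` at the level of polynomials. [folklore] -/
theorem X_mul_derivative_C_mul_sub (P : ℝ[X]) (c : ℝ) :
    X * derivative (C c * P - X * derivative P) = C c * (X * derivative P) - X * derivative (X * derivative P) := by
  rw [derivative_sub, derivative_C_mul]
  ring

/-- ★ **The Wronskian of a reversal**: if `P̃(t) = t^N · P(1/t)` for `t ≠ 0`, then
`W(P̃)(t) = t^{2N} · W(P)(1/t)` for `t ≠ 0`, where `W(Q) = Q·θ²Q − (θQ)²`. [folklore] -/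
theorem wronskian_eval_reverse (P Pr : ℝ[X]) (N : ℕ) (h : ∀ t : ℝ, t ≠ 0 → Pr.eval t = t ^ N * P.eval t⁻¹) {t : ℝ} (ht : t ≠ 0) :
    (Pr * (X * derivative (X * derivative Pr)) - (X * derivative Pr) ^ 2).eval t
      = t ^ (2 * N) * (P * (X * derivative (X * derivative P)) - (X * derivative P) ^ 2).eval t⁻¹ := by
  -- first θ-derivative
  have h1 : ∀ x : ℝ, x ≠ 0 → (X * derivative Pr).eval x = x ^ N * (C (N : ℝ) * P - X * derivative P).eval x⁻¹ :=
    fun x hx => theta_eval_reverse P Pr N h hx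
  -- second θ-derivative: iterate on `θP̃`, whose reversal partner is `N·P − θP`
  have h2 := theta_eval_reverse (C (N : ℝ) * P - X * derivative P) (X * derivative Pr) N h1 ht
  rw [X_mul_derivative_C_mul_sub] at h2
  rw [eval_sub, eval_mul, eval_pow, h2, h1 t ht, h t ht]
  simp only [eval_sub, eval_mul, eval_C, eval_pow]
  ring

/-! ### §2 Root counts under the mirror -/

/-- If `P̃(t) = t^N P(1/t)` on `t ≠ 0` then also `P(t) = t^N P̃(1/t)` on `t ≠ 0`. [folklore] -/
theorem eval_reverse_symm (P Pr : ℝ[X]) (N : ℕ) (h : ∀ t : ℝ, t ≠ 0 → Pr.eval t = t ^ N * P.eval t⁻¹) {t : ℝ} (ht : t ≠ 0) :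
    P.eval t = t ^ N * Pr.eval t⁻¹ := by
  rw [h t⁻¹ (inv_ne_zero ht), inv_inv, inv_pow, ← mul_assoc, mul_inv_cancel₀ (pow_ne_zero _ ht), one_mul]

/-- `W(P) = 0 ⇒ W(P̃) = 0` for a reversal pair. [folklore] -/
theorem wronskian_eq_zero_of_reverse (P Pr : ℝ[X]) (N : ℕ) (h : ∀ t : ℝ, t ≠ 0 → Pr.eval t = t ^ N * P.eval t⁻¹)
    (hW : P * (X * derivative (X * derivative P)) - (X * derivative P) ^ 2 = 0) :
    Pr * (X * derivative (X * derivative Pr)) - (X * derivative Pr) ^ 2 = 0 := by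
  apply Polynomial.eq_zero_of_infinite_isRoot
  apply Set.infinite_of_injective_forall_mem (f := fun n : ℕ => (n : ℝ) + 1)
  · intro x y hxy
    exact_mod_cast (add_left_injective 1 hxy : (x : ℝ) = y)
  · intro n
    have hpos : (0 : ℝ) < n + 1 := by positivity
    show IsRoot _ _
    rw [IsRoot.def, wronskian_eval_reverse P Pr N h hpos.ne', hW, eval_zero, mul_zero]

/-- Window counts under the mirror, one inequality: roots of `W(P̃)` in `(u,v)` inject (`t ↦ t⁻¹`) into roots of `W(P)` in `(1/v, 1/u)`
(`0 < u`, `0 < v`). [folklore] -/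
theorem wronskian_roots_window_reverse_le (P Pr : ℝ[X]) (N : ℕ) (h : ∀ t : ℝ, t ≠ 0 → Pr.eval t = t ^ N * P.eval t⁻¹) {u v : ℝ}
    (hu : 0 < u) (hv : 0 < v) :
    ((Pr * (X * derivative (X * derivative Pr)) - (X * derivative Pr) ^ 2).roots.toFinset.filter (fun t => u < t ∧ t < v)).card
      ≤ ((P * (X * derivative (X * derivative P)) - (X * derivative P) ^ 2).roots.toFinset.filter (fun t => v⁻¹ < t ∧ t < u⁻¹)).card := by
  classical
  by_cases hW : P * (X * derivative (X * derivative P)) - (X * derivative P) ^ 2 = 0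
  · rw [wronskian_eq_zero_of_reverse P Pr N h hW, hW, roots_zero, Multiset.toFinset_zero, Finset.filter_empty, Finset.filter_empty]
  refine Finset.card_le_card_of_injOn (fun t => t⁻¹) (fun t ht => ?_) (fun x _ y _ hxy => inv_injective hxy)
  rw [mem_coe, mem_filter, Multiset.mem_toFinset] at ht
  have ht0 : 0 < t := hu.trans ht.2.1
  have hWr : Pr * (X * derivative (X * derivative Pr)) - (X * derivative Pr) ^ 2 ≠ 0 := by
    intro h0
    rw [h0, roots_zero] at ht
    exact Multiset.notMem_zero _ ht.1
  have hroot := (mem_roots hWr).mp ht.1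
  rw [IsRoot.def, wronskian_eval_reverse P Pr N h ht0.ne'] at hroot
  rw [mem_coe, mem_filter, Multiset.mem_toFinset, mem_roots hW, IsRoot.def]
  refine ⟨?_, (inv_lt_inv₀ hv ht0).2 ht.2.2, (inv_lt_inv₀ ht0 hu).2 ht.2.1⟩
  rcases mul_eq_zero.mp hroot with h0 | h0
  · exact absurd h0 (pow_ne_zero _ ht0.ne')
  · exact h0

/-- ★ **Window counts under the mirror**: `#{roots of W(P̃) in (u,v)} = #{roots of W(P) in (1/v,1/u)}` for a reversal pair and `0 < u`, `0 < v`.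
[folklore] -/
theorem wronskian_roots_window_reverse (P Pr : ℝ[X]) (N : ℕ) (h : ∀ t : ℝ, t ≠ 0 → Pr.eval t = t ^ N * P.eval t⁻¹) {u v : ℝ}
    (hu : 0 < u) (hv : 0 < v) :
    ((Pr * (X * derivative (X * derivative Pr)) - (X * derivative Pr) ^ 2).roots.toFinset.filter (fun t => u < t ∧ t < v)).card
      = ((P * (X * derivative (X * derivative P)) - (X * derivative P) ^ 2).roots.toFinset.filter (fun t => v⁻¹ < t ∧ t < u⁻¹)).card := by
  refine le_antisymm (wronskian_roots_window_reverse_le P Pr N h hu hv) ?_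
  have h' := wronskian_roots_window_reverse_le Pr P N (fun _ ht => eval_reverse_symm P Pr N h ht) (inv_pos.2 hv) (inv_pos.2 hu)
  simpa only [inv_inv] using h'

/-- Positive-root counts under the mirror, one inequality. [folklore] -/
theorem wronskian_posRoots_reverse_le (P Pr : ℝ[X]) (N : ℕ) (h : ∀ t : ℝ, t ≠ 0 → Pr.eval t = t ^ N * P.eval t⁻¹) :
    ((Pr * (X * derivative (X * derivative Pr)) - (X * derivative Pr) ^ 2).roots.toFinset.filter (fun t => 0 < t)).card
      ≤ ((P * (X * derivative (X * derivative P)) - (X * derivative P) ^ 2).roots.toFinset.filter (fun t => 0 < t)).card := by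
  classical
  by_cases hW : P * (X * derivative (X * derivative P)) - (X * derivative P) ^ 2 = 0
  · rw [wronskian_eq_zero_of_reverse P Pr N h hW, hW]
  refine Finset.card_le_card_of_injOn (fun t => t⁻¹) (fun t ht => ?_) (fun x _ y _ hxy => inv_injective hxy)
  rw [mem_coe, mem_filter, Multiset.mem_toFinset] at ht
  have ht0 : 0 < t := ht.2
  have hWr : Pr * (X * derivative (X * derivative Pr)) - (X * derivative Pr) ^ 2 ≠ 0 := by
    intro h0
    rw [h0, roots_zero] at ht
    exact Multiset.notMem_zero _ ht.1
  have hroot := (mem_roots hWr).mp ht.1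
  rw [IsRoot.def, wronskian_eval_reverse P Pr N h ht0.ne'] at hroot
  rw [mem_coe, mem_filter, Multiset.mem_toFinset, mem_roots hW, IsRoot.def]
  refine ⟨?_, inv_pos.2 ht0⟩
  rcases mul_eq_zero.mp hroot with h0 | h0
  · exact absurd h0 (pow_ne_zero _ ht0.ne')
  · exact h0

/-- ★ **Positive-root counts under the mirror**: `Z₊(W(P̃)) = Z₊(W(P))` for a reversal pair. [folklore] -/
theorem wronskian_posRoots_reverse (P Pr : ℝ[X]) (N : ℕ) (h : ∀ t : ℝ, t ≠ 0 → Pr.eval t = t ^ N * P.eval t⁻¹) :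
    ((Pr * (X * derivative (X * derivative Pr)) - (X * derivative Pr) ^ 2).roots.toFinset.filter (fun t => 0 < t)).card
      = ((P * (X * derivative (X * derivative P)) - (X * derivative P) ^ 2).roots.toFinset.filter (fun t => 0 < t)).card :=
  le_antisymm (wronskian_posRoots_reverse_le P Pr N h)
    (wronskian_posRoots_reverse_le Pr P N (fun _ ht => eval_reverse_symm P Pr N h ht))

/-! ### §3 The company instances -/

/-- **Reversal identity for a company**: `∏_j Σ_l a_{jl} t^{D − d_l} = t^{m·D} · ∏_j Σ_l a_{jl} (1/t)^{d_l}` for `t ≠ 0`, `d_l ≤ D`. [folklore] -/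
theorem company_eval_reverse {m K : ℕ} (d : Fin K → ℕ) (D : ℕ) (hD : ∀ l, d l ≤ D) (a : Fin m → Fin K → ℝ) {t : ℝ} (ht : t ≠ 0) :
    (∏ j, ∑ l, C (a j l) * X ^ (D - d l) : ℝ[X]).eval t = t ^ (m * D) * (∏ j, ∑ l, C (a j l) * X ^ (d l) : ℝ[X]).eval t⁻¹ := by
  simp only [eval_prod, eval_finsetSum, eval_mul, eval_C, eval_pow, eval_X]
  have hpow : ∀ n : ℕ, n ≤ D → t ^ (D - n) = t ^ D * t⁻¹ ^ n := by
    intro n hn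
    rw [inv_pow, ← div_eq_mul_inv, eq_div_iff (pow_ne_zero _ ht), ← pow_add, Nat.sub_add_cancel hn]
  have hc : (t ^ D) ^ m = ∏ _j : Fin m, t ^ D := by
    rw [Finset.prod_const, Finset.card_univ, Fintype.card_fin]
  rw [pow_mul', hc, ← Finset.prod_mul_distrib]
  refine Finset.prod_congr rfl (fun j _ => ?_)
  rw [Finset.mul_sum]
  refine Finset.sum_congr rfl (fun l _ => ?_)
  rw [hpow (d l) (hD l)]
  ring

/-- ★★ **W-currency mirror for companies, window counts**: the Wronskian of the support-reversed company `∏_j Σ_l C (a j l) X^{D − d l}` has as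
many roots in `(u,v)` as the Wronskian of `∏_j Σ_l C (a j l) X^{d l}` has in `(1/v, 1/u)` (`0 < u`, `0 < v`). [this file's theorem] -/
theorem company_wronskian_roots_window_reverse {m K : ℕ} (d : Fin K → ℕ) (D : ℕ) (hD : ∀ l, d l ≤ D) (a : Fin m → Fin K → ℝ)
    {u v : ℝ} (hu : 0 < u) (hv : 0 < v) :
    (((∏ j, ∑ l, C (a j l) * X ^ (D - d l) : ℝ[X]) * (X * derivative (X * derivative (∏ j, ∑ l, C (a j l) * X ^ (D - d l) : ℝ[X])))
        - (X * derivative (∏ j, ∑ l, C (a j l) * X ^ (D - d l) : ℝ[X])) ^ 2).roots.toFinset.filter (fun t => u < t ∧ t < v)).card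
      = (((∏ j, ∑ l, C (a j l) * X ^ (d l) : ℝ[X]) * (X * derivative (X * derivative (∏ j, ∑ l, C (a j l) * X ^ (d l) : ℝ[X])))
        - (X * derivative (∏ j, ∑ l, C (a j l) * X ^ (d l) : ℝ[X])) ^ 2).roots.toFinset.filter (fun t => v⁻¹ < t ∧ t < u⁻¹)).card :=
  wronskian_roots_window_reverse _ _ (m * D) (fun _ ht => company_eval_reverse d D hD a ht) hu hv

/-- ★★ **W-currency mirror for companies, positive roots**: `Z₊(W(∏ reversed rows)) = Z₊(W(∏ rows))`. [this file's theorem] -/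
theorem company_wronskian_posRoots_reverse {m K : ℕ} (d : Fin K → ℕ) (D : ℕ) (hD : ∀ l, d l ≤ D) (a : Fin m → Fin K → ℝ) :
    (((∏ j, ∑ l, C (a j l) * X ^ (D - d l) : ℝ[X]) * (X * derivative (X * derivative (∏ j, ∑ l, C (a j l) * X ^ (D - d l) : ℝ[X])))
        - (X * derivative (∏ j, ∑ l, C (a j l) * X ^ (D - d l) : ℝ[X])) ^ 2).roots.toFinset.filter (fun t => 0 < t)).card
      = (((∏ j, ∑ l, C (a j l) * X ^ (d l) : ℝ[X]) * (X * derivative (X * derivative (∏ j, ∑ l, C (a j l) * X ^ (d l) : ℝ[X])))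
        - (X * derivative (∏ j, ∑ l, C (a j l) * X ^ (d l) : ℝ[X])) ^ 2).roots.toFinset.filter (fun t => 0 < t)).card :=
  wronskian_posRoots_reverse _ _ (m * D) (fun _ ht => company_eval_reverse d D hD a ht)

end ProductPlusOne

end Summit.ValiantsHypothesis.ValiantsHypothesis.Theorems.LacunarySymmetroidMatrixDescartes
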